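/-
Copyright (c) 2026 the pub-hodgecm-mathlib formalisation cell (harness21).  Prover seat hodgecm-mathlib-K2-defs1 (g5), Track B ∕ K2-LIT,
h413 = `stmt-HodgeConjecture-24833`, line `K2_E1_TraceFormulaBeta`, campaign «EIS-WHITTAKER-3» WAVE 1, deal D-W3 · J2₃-fin of the dealer K2E1-plan (g5)
(DEALS memo `K2/K2E1-plan/g5/DEALS-EIS-WHITTAKER-3-wave1.K2E1-plan-g5.md` fe56b7cd5d935977 §D-W3), FILE A: the finite Fourier–Jacobi local integral with a FLOOR,
`∫_F max(‖a‖, ‖t‖)^{−2z} ψ(tξ) dμ(t) = ‖a‖^{1−2z} · ∫_F max(1, ‖u‖)^{−2z} ψ(u·aξ) dμ(u)` — one dilation, then ★ W2-fin p858310 BY NAME at the frequency `aξ`.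
-/
import Summits.HodgeConjecture.HodgeConjecture.Theorems.K2E1FiniteWhittakerPolynomial   -- ★ p858310 (K2-defs1 (g4)): closed form ∕ vanishing ∕ unit value ∕ entire ∕ `2(n+1)μ(𝒪)` bound of `∫ max(1,‖t‖)^{−2z}ψ(tξ)`
import Literature.NumberTheory.Automorphic.TateLocalZetaShells                           -- ★ `integral_comp_mul_left` (`∫ φ(ax) dμ = ‖a⁻¹‖ • ∫ φ dμ`), `integrable_comp_mul_left_iff`
import HarnessLib

/-!
# h413 ∕ Track B «K2-LIT», «EIS-WHITTAKER-3» D-W3 · J2₃-fin — `K2E1FourierJacobiLocalFiniteU3` (FILE A): the finite-place Fourier–Jacobi integral of the spherical section of `U(2,1)`,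
# `𝓙(a, ξ, z) = ∫_F max(‖a‖,‖t‖)^{−2z} ψ(tξ) dμ(t) = ‖a‖^{1−2z} · μ(𝒪)(1 − q^{−2z}) Σ_{k=0}^{n} q^{k(1−2z)}` (`n = ord(aξ) − cond ψ ≥ 0`), `= 0` if `aξ ∉ 𝔭^{cond ψ}`

Cell `pub/hodgecm-mathlib`, crux H413 = `stmt-HodgeConjecture-24833`, route `HCCMUnconditional`; dealer K2E1-plan (g5), campaign spec = K2E1b-plan (g6) CENSUS ba907189b20ed180 §3 (iii) and
CONVENTIONS W0₃ 2fdd2f7063acaab9 §4 (i): at an inert unramified place `v` of `L⁺` the `t`-integrand of the Fourier–Jacobi coefficient `𝓕_F[Φ_k(x₀,·)](η)` is `max(R, |t|_v)^{−2z}ψ̄_v(ηt)` with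
the FLOOR `R = max(1, ‖(x₀)_w‖_w) = q_v^{r} ∈ |F_v^×|`, and `𝓙_v(x₀,η,z) = R^{1−2z}·P_{F_v}(ηϖ^{−r}; 2z)`, SUPPORT `ord_v η ≥ m_v + r`, UNIT VALUE `1 − q_v^{−2z}`, INDEX `2z` — ★ W2-fin
p858310 VERBATIM over `F_v` after ONE substitution.  THEOREMS ONLY (no `def`, no `instance`, no `notation`, no named-fact hypothesis, no `sorry`; default heartbeats); lane
`--kind proof --supports stmt-HodgeConjecture-24833 --as helper` (count-neutral).  ONE local field `F` (`[IsNonarchimedeanLocalField F]`), ANY Haar `μ` (`μ.real (primePowBall F 0)`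
visible), `ψ : AddChar F Circle` continuous of conductor exponent `m`, the letters of ★ p858310 VERBATIM; the floor is carried by an ELEMENT `a : F`, `a ≠ 0` (`R = ‖a‖`; the consumer
picks `a` with `‖a‖_v = max(1, ‖(x₀)_w‖_w) ∈ q_v^{2ℤ}` by ★ `exists_normAbs_eq_inv_zpow_of_int`), so NO uniformizer is chosen and the shifted frequency is simply `aξ`.

THE MATHEMATICS (Gelbart–Piatetski-Shapiro 1984 §4; Tate 1950 §2.2, §2.5).  Substituting `t = a·u` (Tate's `∫ f(t) dμ(t) = ‖a‖∫ f(au) dμ(u)`, ★ `integral_comp_mul_left`) and using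
`max(‖a‖, ‖a‖‖u‖) = ‖a‖·max(1,‖u‖)` gives, for EVERY `z` (no integrability needed — both sides share the Bochner convention),
  **`∫_F max(‖a‖,‖t‖)^{−2z} ψ(tξ) dμ(t) = ‖a‖^{1−2z} · ∫_F max(1,‖u‖)^{−2z} ψ(u·(aξ)) dμ(u)`**   (§2),
and the right-hand integral is ★ W2-fin's `I(aξ, z)`: closed form `μ(𝒪)(1−q^{−2z})Σ_{k=0}^{n}(q^{1−2z})^k` for `aξ ∈ 𝔭^{m+n} ∖ 𝔭^{m+n+1}` and `Re z > ½`, `= 0` for `aξ ∉ 𝔭^m` (SUPPORT: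
`ord(aξ) ≥ m` ⟺ `‖a‖·‖ξ‖ ≤ q^{−m}` ⟺ «`|η|_v·R ≤ q_v^{−m_v}`»), `= μ(𝒪)(1 − q^{−2z})` when `m = 0` and `‖aξ‖ = 1` (UNIT VALUE; with `‖a‖ = 1`: the unramified factor `1∕ζ_{F}(2z)` of the FJ
layer's normaliser `ζ^{S}_{L⁺}(2z)⁻¹`) (§3); the prefactor `‖a‖^{1−2z}` is ENTIRE with `‖·‖ = ‖a‖^{1−2Re z} ≤ 1` for `‖a‖ ≥ 1`, `Re z ≥ ½`, so the value is ENTIRE in `z` and bounded by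
`2(n+1)μ(𝒪)` on `Re z ≥ ½` UNIFORMLY IN THE FLOOR `R ≥ 1` (§4) — what J4₃ sums.  FILE B (split places: two floors and a shift) is separate.

* §1 `max_normAbs_normAbs_mul`, `floorWeight_mul_eq` (pointwise dilation of the symbol).
* §2 **`integral_floorWeight_mul_addChar_eq`** (every `z`), `integrable_floorWeight_mul_addChar` (`Re z > ½`).
* §3 **`integral_floorWeight_mul_addChar_eq_closedForm`**, **`integral_floorWeight_mul_addChar_eq_zero_of_not_mem`**, `…_eq_zero_of_lt` (SUPPORT in `normAbs` letters),
  **`integral_floorWeight_mul_addChar_eq_of_conductor_zero_of_normAbs_mul_eq_one`** (UNIT VALUE), `…_of_normAbs_eq_one` (`‖a‖ = 1`).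
* §4 `norm_cpow_one_sub_two_mul_le_one`, **`differentiable_floorClosedForm`** (ENTIRE), **`norm_floorClosedForm_le`** (`≤ 2(n+1)M`, uniform in `R ≥ 1`).
HONEST LABEL.  Count-neutral helper; proves no printed statement; HC_CM is proved only modulo the 7 printed citations (2 remaining named inputs: hLiu418 =
`stmt-HodgeConjecture-24832`, h413 = `stmt-HodgeConjecture-24833`) until rung 0 closes.

## References
* [GelbartPiatetskiShapiro1984] S. Gelbart, I. Piatetski-Shapiro, *Automorphic forms and L-functions for the unitary group*, in LNM 1041 (1984), §4 (4.5) (Fourier–Jacobi coefficients of Eisenstein series on `U(2,1)`).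
* [Tate1950] J. Tate, *Fourier analysis in number fields and Hecke's zeta-functions* (1950), §2.2 Lemma 2.2.5 (`d(αξ) = |α| dξ`), §2.5; in [CasselsFrohlichANT1967] Ch. XV.
* [Casselman1980] W. Casselman, *The unramified principal series of p-adic groups I*, Compositio Math. 40 (1980), §3.
-/

set_option autoImplicit false
set_option linter.dupNamespace false  -- the mandated namespace repeats the summit's segment (`HodgeConjecture.HodgeConjecture`)

noncomputable section

open MeasureTheory Filter Topology Set
open scoped NNReal ENNReal
open Literature.NumberTheory.GaloisRepresentations.IsNonarchimedeanLocalField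
open Literature.NumberTheory.Automorphic Literature.NumberTheory.Automorphic.LocalFieldHaar
open Summit.HodgeConjecture.HodgeConjecture.Cruxes.H413.K2E1FiniteWhittakerPolynomial

namespace Summit.HodgeConjecture.HodgeConjecture.Cruxes.H413.K2E1FourierJacobiLocalFiniteU3

variable {F : Type*} [Field F] [ValuativeRel F] [TopologicalSpace F] [IsNonarchimedeanLocalField F]

/-! ## §1 The floor symbol under the dilation `t = a·u` -/

/-- `max(‖a‖, ‖a·u‖) = ‖a‖ · max(1, ‖u‖)` (`‖·‖ = normAbs F` multiplicative, `‖a‖ ≥ 0`). [folklore] -/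
theorem max_normAbs_normAbs_mul (a u : F) :
    max ((normAbs F a : ℝ≥0) : ℝ) ((normAbs F (a * u) : ℝ≥0) : ℝ) = ((normAbs F a : ℝ≥0) : ℝ) * max 1 ((normAbs F u : ℝ≥0) : ℝ) := by
  rw [map_mul, NNReal.coe_mul, mul_max_of_nonneg _ _ (NNReal.coe_nonneg _), mul_one]

/-- The symbol dilates: `max(‖a‖,‖a·u‖)^{−2z} = ‖a‖^{−2z} · max(1,‖u‖)^{−2z}` (complex powers of non-negative reals, Mathlib `Complex.mul_cpow_ofReal_nonneg`). [folklore] -/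
theorem floorWeight_mul_eq (a u : F) (z : ℂ) :
    (((max ((normAbs F a : ℝ≥0) : ℝ) ((normAbs F (a * u) : ℝ≥0) : ℝ) : ℝ) : ℂ) ^ (-(2 * z))) =
      (((normAbs F a : ℝ≥0) : ℝ) : ℂ) ^ (-(2 * z)) * (((max 1 ((normAbs F u : ℝ≥0) : ℝ) : ℝ) : ℂ) ^ (-(2 * z))) := by
  rw [max_normAbs_normAbs_mul, Complex.ofReal_mul,
    Complex.mul_cpow_ofReal_nonneg (NNReal.coe_nonneg _) (le_max_of_le_left zero_le_one)]

variable [MeasurableSpace F] [BorelSpace F] (μ : Measure F) [μ.IsAddHaarMeasure]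

/-! ## §2 The dilation identity (every `z`) -/

/-- **THE FLOOR IS A DILATION**: for `a ≠ 0`, every `ξ` and EVERY `z`,
`∫_F max(‖a‖,‖t‖)^{−2z} ψ(tξ) dμ(t) = ‖a‖^{1−2z} · ∫_F max(1,‖u‖)^{−2z} ψ(u·(aξ)) dμ(u)` (Tate's substitution `t = a·u`, ★ `integral_comp_mul_left`; no integrability hypothesis).
[cite: Tate1950, §2.2, Lemma 2.2.5] [cite: GelbartPiatetskiShapiro1984, §4 (4.5)] -/
theorem integral_floorWeight_mul_addChar_eq (ψ : AddChar F Circle) {a : F} (ha : a ≠ 0) (ξ : F) (z : ℂ) :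
    ∫ t, (((max ((normAbs F a : ℝ≥0) : ℝ) ((normAbs F t : ℝ≥0) : ℝ) : ℝ) : ℂ) ^ (-(2 * z))) * ((ψ (t * ξ) : Circle) : ℂ) ∂μ =
      (((normAbs F a : ℝ≥0) : ℝ) : ℂ) ^ (1 - 2 * z) *
        ∫ u, (((max 1 ((normAbs F u : ℝ≥0) : ℝ) : ℝ) : ℂ) ^ (-(2 * z))) * ((ψ (u * (a * ξ)) : Circle) : ℂ) ∂μ := by
  have hna : (normAbs F a : ℝ≥0) ≠ 0 := (map_ne_zero (normAbs F)).mpr ha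
  have hA0 : (((normAbs F a : ℝ≥0) : ℝ) : ℂ) ≠ 0 := by exact_mod_cast hna
  have hsub := integral_comp_mul_left μ (inv_ne_zero ha)
    (fun u : F => (((max ((normAbs F a : ℝ≥0) : ℝ) ((normAbs F (a * u) : ℝ≥0) : ℝ) : ℝ) : ℂ) ^ (-(2 * z))) * ((ψ (a * u * ξ) : Circle) : ℂ))
  simp only [mul_inv_cancel_left₀ ha, inv_inv] at hsub
  rw [hsub]
  have hpt : (fun u : F => (((max ((normAbs F a : ℝ≥0) : ℝ) ((normAbs F (a * u) : ℝ≥0) : ℝ) : ℝ) : ℂ) ^ (-(2 * z))) * ((ψ (a * u * ξ) : Circle) : ℂ)) =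
      fun u : F => (((normAbs F a : ℝ≥0) : ℝ) : ℂ) ^ (-(2 * z)) *
        ((((max 1 ((normAbs F u : ℝ≥0) : ℝ) : ℝ) : ℂ) ^ (-(2 * z))) * ((ψ (u * (a * ξ)) : Circle) : ℂ)) := by
    funext u
    rw [floorWeight_mul_eq, mul_assoc, show a * u * ξ = u * (a * ξ) by ring]
  rw [hpt, integral_const_mul, Complex.real_smul, ← mul_assoc, sub_eq_add_neg, Complex.cpow_add _ _ hA0, Complex.cpow_one]

/-- For `Re z > ½` the floor integrand `max(‖a‖,‖t‖)^{−2z} ψ(tξ)` is integrable on `F` (`a ≠ 0`; ★ `integrable_weight_mul_addChar` transported by `t = a·u`). [cite: Casselman1980, §3] -/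
theorem integrable_floorWeight_mul_addChar {ψ : AddChar F Circle} (hψ : Continuous ψ) {a : F} (ha : a ≠ 0) (ξ : F) {z : ℂ} (hz : 1 / 2 < z.re) :
    Integrable (fun t : F => (((max ((normAbs F a : ℝ≥0) : ℝ) ((normAbs F t : ℝ≥0) : ℝ) : ℝ) : ℂ) ^ (-(2 * z))) * ((ψ (t * ξ) : Circle) : ℂ)) μ := by
  refine (integrable_comp_mul_left_iff μ ha
    (fun t : F => (((max ((normAbs F a : ℝ≥0) : ℝ) ((normAbs F t : ℝ≥0) : ℝ) : ℝ) : ℂ) ^ (-(2 * z))) * ((ψ (t * ξ) : Circle) : ℂ))).mp ?_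
  have hpt : (fun u : F => (((max ((normAbs F a : ℝ≥0) : ℝ) ((normAbs F (a * u) : ℝ≥0) : ℝ) : ℝ) : ℂ) ^ (-(2 * z))) * ((ψ (a * u * ξ) : Circle) : ℂ)) =
      fun u : F => (((normAbs F a : ℝ≥0) : ℝ) : ℂ) ^ (-(2 * z)) *
        ((((max 1 ((normAbs F u : ℝ≥0) : ℝ) : ℝ) : ℂ) ^ (-(2 * z))) * ((ψ (u * (a * ξ)) : Circle) : ℂ)) := by
    funext u
    rw [floorWeight_mul_eq, mul_assoc, show a * u * ξ = u * (a * ξ) by ring]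
  change Integrable (fun u : F => (((max ((normAbs F a : ℝ≥0) : ℝ) ((normAbs F (a * u) : ℝ≥0) : ℝ) : ℝ) : ℂ) ^ (-(2 * z))) * ((ψ (a * u * ξ) : Circle) : ℂ)) μ
  rw [hpt]
  exact (integrable_weight_mul_addChar μ hψ (a * ξ) hz).const_mul _

/-! ## §3 Closed form, support, unit value — ★ W2-fin BY NAME at the frequency `aξ` -/

/-- **THE FOURIER–JACOBI LOCAL INTEGRAL IN CLOSED FORM**: for `a ≠ 0`, `aξ ∈ 𝔭^{m+n} ∖ 𝔭^{m+n+1}` (`n = ord(aξ) − m ≥ 0`) and `Re z > ½`,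
`∫_F max(‖a‖,‖t‖)^{−2z} ψ(tξ) dμ = ‖a‖^{1−2z} · μ(𝒪)·(1 − q^{−2z})·Σ_{k=0}^{n} (q^{−2z}·q)^k` = «`R^{1−2z}·P(ηϖ^{−r}; 2z)`» of CONVENTIONS W0₃ §4 (i).
[cite: GelbartPiatetskiShapiro1984, §4 (4.5)] [cite: Tate1950, §2.5] [cite: Casselman1980, §3] -/
theorem integral_floorWeight_mul_addChar_eq_closedForm {ψ : AddChar F Circle} (hψ : Continuous ψ) {m : ℤ} (hm : ψ.HasConductorExp m) {a : F} (ha : a ≠ 0)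
    {ξ : F} {n : ℕ} (hn : a * ξ ∈ primePowBall F (m + n)) (hn' : a * ξ ∉ primePowBall F (m + n + 1)) {z : ℂ} (hz : 1 / 2 < z.re) :
    ∫ t, (((max ((normAbs F a : ℝ≥0) : ℝ) ((normAbs F t : ℝ≥0) : ℝ) : ℝ) : ℂ) ^ (-(2 * z))) * ((ψ (t * ξ) : Circle) : ℂ) ∂μ =
      (((normAbs F a : ℝ≥0) : ℝ) : ℂ) ^ (1 - 2 * z) * ((μ.real (primePowBall F 0) : ℂ) * ((1 - (residueFieldCard F : ℂ) ^ (-(2 * z))) *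
        ∑ k ∈ Finset.range (n + 1), ((residueFieldCard F : ℂ) ^ (-(2 * z)) * (residueFieldCard F : ℂ)) ^ k)) := by
  rw [integral_floorWeight_mul_addChar_eq μ ψ ha ξ z, integral_weight_mul_addChar_eq_closedForm μ hψ hm hn hn' hz]

/-- **SUPPORT**: if `aξ ∉ 𝔭^m` (i.e. `ord(aξ) < cond ψ`, «`|η|_v·R > q_v^{−m_v}`») then `∫_F max(‖a‖,‖t‖)^{−2z} ψ(tξ) dμ = 0` (`Re z > ½`).
[cite: GelbartPiatetskiShapiro1984, §4 (4.5)] [cite: Tate1950, §2.5] -/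
theorem integral_floorWeight_mul_addChar_eq_zero_of_not_mem {ψ : AddChar F Circle} (hψ : Continuous ψ) {m : ℤ} (hm : ψ.HasConductorExp m) {a : F} (ha : a ≠ 0)
    {ξ : F} (hξ : a * ξ ∉ primePowBall F m) {z : ℂ} (hz : 1 / 2 < z.re) :
    ∫ t, (((max ((normAbs F a : ℝ≥0) : ℝ) ((normAbs F t : ℝ≥0) : ℝ) : ℝ) : ℂ) ^ (-(2 * z))) * ((ψ (t * ξ) : Circle) : ℂ) ∂μ = 0 := by
  rw [integral_floorWeight_mul_addChar_eq μ ψ ha ξ z, integral_weight_mul_addChar_eq_zero_of_not_mem μ hψ hm hξ hz, mul_zero]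

/-- SUPPORT in `normAbs` letters: the integral vanishes as soon as `‖a‖·‖ξ‖ > q^{−m}` (the floor times the frequency leaves the conductor ball). [cite: Tate1950, §2.5] -/
theorem integral_floorWeight_mul_addChar_eq_zero_of_lt {ψ : AddChar F Circle} (hψ : Continuous ψ) {m : ℤ} (hm : ψ.HasConductorExp m) {a : F} (ha : a ≠ 0)
    {ξ : F} (h : (residueFieldCard F : ℝ≥0)⁻¹ ^ m < normAbs F a * normAbs F ξ) {z : ℂ} (hz : 1 / 2 < z.re) :
    ∫ t, (((max ((normAbs F a : ℝ≥0) : ℝ) ((normAbs F t : ℝ≥0) : ℝ) : ℝ) : ℂ) ^ (-(2 * z))) * ((ψ (t * ξ) : Circle) : ℂ) ∂μ = 0 :=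
  integral_floorWeight_mul_addChar_eq_zero_of_not_mem μ hψ hm ha (fun hmem => not_le.mpr h (by rw [← map_mul]; exact mem_primePowBall_iff.mp hmem)) hz

/-- **UNIT VALUE** (conductor `𝒪`, `‖a‖·‖ξ‖ = 1`): `∫_F max(‖a‖,‖t‖)^{−2z} ψ(tξ) dμ = ‖a‖^{1−2z} · μ(𝒪)·(1 − q^{−2z})` (`Re z > ½`; ★ W2-fin (d) at the unit `aξ`).
[cite: GelbartPiatetskiShapiro1984, §4 (4.5)] [cite: Casselman1980, §3] -/
theorem integral_floorWeight_mul_addChar_eq_of_conductor_zero_of_normAbs_mul_eq_one {ψ : AddChar F Circle} (hψ : Continuous ψ) (h0 : ψ.HasConductorExp 0)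
    {a : F} (ha : a ≠ 0) {ξ : F} (h1 : normAbs F a * normAbs F ξ = 1) {z : ℂ} (hz : 1 / 2 < z.re) :
    ∫ t, (((max ((normAbs F a : ℝ≥0) : ℝ) ((normAbs F t : ℝ≥0) : ℝ) : ℝ) : ℂ) ^ (-(2 * z))) * ((ψ (t * ξ) : Circle) : ℂ) ∂μ =
      (((normAbs F a : ℝ≥0) : ℝ) : ℂ) ^ (1 - 2 * z) * ((μ.real (primePowBall F 0) : ℂ) * (1 - (residueFieldCard F : ℂ) ^ (-(2 * z)))) := by
  rw [integral_floorWeight_mul_addChar_eq μ ψ ha ξ z,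
    integral_weight_mul_addChar_eq_of_conductor_zero_of_normAbs_eq_one μ hψ h0 (by rw [map_mul, h1]) hz]

/-- **THE UNRAMIFIED FOURIER–JACOBI FACTOR** (`‖a‖ = 1`, `‖ξ‖ = 1`, conductor `𝒪`): `∫_F max(‖a‖,‖t‖)^{−2z} ψ(tξ) dμ = μ(𝒪)·(1 − q^{−2z})` — the local factor of the FJ layer's
normaliser `ζ^{S}_{L⁺}(2z)⁻¹` at almost every place (CONVENTIONS W0₃ §4 (i)). [cite: GelbartPiatetskiShapiro1984, §4 (4.5)] [cite: Casselman1980, §3] -/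
theorem integral_floorWeight_mul_addChar_eq_of_normAbs_eq_one {ψ : AddChar F Circle} (hψ : Continuous ψ) (h0 : ψ.HasConductorExp 0)
    {a : F} (ha1 : normAbs F a = 1) {ξ : F} (hξ : normAbs F ξ = 1) {z : ℂ} (hz : 1 / 2 < z.re) :
    ∫ t, (((max ((normAbs F a : ℝ≥0) : ℝ) ((normAbs F t : ℝ≥0) : ℝ) : ℝ) : ℂ) ^ (-(2 * z))) * ((ψ (t * ξ) : Circle) : ℂ) ∂μ =
      (μ.real (primePowBall F 0) : ℂ) * (1 - (residueFieldCard F : ℂ) ^ (-(2 * z))) := by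
  have ha : a ≠ 0 := fun h => zero_ne_one (by rw [← ha1, h, map_zero])
  rw [integral_floorWeight_mul_addChar_eq_of_conductor_zero_of_normAbs_mul_eq_one μ hψ h0 ha (by rw [ha1, hξ, one_mul]) hz, ha1, NNReal.coe_one,
    Complex.ofReal_one, Complex.one_cpow, one_mul]

/-! ## §4 Entire in `z`; the trivial bound, uniform in the floor `R ≥ 1` -/

omit [MeasurableSpace F] [BorelSpace F] in
/-- `‖R^{1−2z}‖ = R^{1−2Re z} ≤ 1` for a floor `R ≥ 1` and `Re z ≥ ½`. [folklore] -/
theorem norm_cpow_one_sub_two_mul_le_one {R : ℝ} (hR : 1 ≤ R) {z : ℂ} (hz : 1 / 2 ≤ z.re) : ‖((R : ℝ) : ℂ) ^ (1 - 2 * z)‖ ≤ 1 := by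
  rw [Complex.norm_cpow_eq_rpow_re_of_pos (by linarith) (1 - 2 * z)]
  refine Real.rpow_le_one_of_one_le_of_nonpos hR ?_
  simp only [Complex.sub_re, Complex.one_re, Complex.mul_re, Complex.re_ofNat, Complex.im_ofNat, zero_mul, sub_zero]
  linarith

omit [MeasurableSpace F] [BorelSpace F] in
/-- **The floored closed form is ENTIRE in `z`** (`R > 0`: `R^{1−2z}` × a polynomial in `q^{−z}`; ★ `differentiable_closedForm`). [cite: Casselman1980, §3] -/
theorem differentiable_floorClosedForm {R : ℝ} (hR : 0 < R) (M : ℂ) (n : ℕ) :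
    Differentiable ℂ fun z : ℂ => ((R : ℝ) : ℂ) ^ (1 - 2 * z) * (M * ((1 - (residueFieldCard F : ℂ) ^ (-(2 * z))) *
      ∑ k ∈ Finset.range (n + 1), ((residueFieldCard F : ℂ) ^ (-(2 * z)) * (residueFieldCard F : ℂ)) ^ k)) := by
  have hR0 : ((R : ℝ) : ℂ) ≠ 0 := by exact_mod_cast hR.ne'
  exact (((differentiable_const (1 : ℂ)).sub (differentiable_id.const_mul (2 : ℂ))).const_cpow (Or.inl hR0)).mul (differentiable_closedForm M n)

omit [MeasurableSpace F] [BorelSpace F] in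
/-- **The trivial bound, UNIFORM IN THE FLOOR**: for `R ≥ 1`, `M ≥ 0` and `Re z ≥ ½`, `‖R^{1−2z} · M(1 − q^{−2z})Σ_{k≤n}(q^{1−2z})^k‖ ≤ 2(n+1)·M` (★ `norm_closedForm_le`, `‖R^{1−2z}‖ ≤ 1`)
— the FJ local factor is bounded by a polynomial in the frequency exponent `n`, independently of `x₀`, which is what the lattice sum J4₃ needs. [cite: Casselman1980, §3] -/
theorem norm_floorClosedForm_le {R : ℝ} (hR : 1 ≤ R) {M : ℝ} (hM : 0 ≤ M) (n : ℕ) {z : ℂ} (hz : 1 / 2 ≤ z.re) :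
    ‖((R : ℝ) : ℂ) ^ (1 - 2 * z) * ((M : ℂ) * ((1 - (residueFieldCard F : ℂ) ^ (-(2 * z))) *
      ∑ k ∈ Finset.range (n + 1), ((residueFieldCard F : ℂ) ^ (-(2 * z)) * (residueFieldCard F : ℂ)) ^ k))‖ ≤ 2 * (n + 1) * M := by
  rw [norm_mul]
  calc ‖((R : ℝ) : ℂ) ^ (1 - 2 * z)‖ * ‖(M : ℂ) * ((1 - (residueFieldCard F : ℂ) ^ (-(2 * z))) *
          ∑ k ∈ Finset.range (n + 1), ((residueFieldCard F : ℂ) ^ (-(2 * z)) * (residueFieldCard F : ℂ)) ^ k)‖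
        ≤ 1 * (2 * (n + 1) * M) := mul_le_mul (norm_cpow_one_sub_two_mul_le_one hR hz) (norm_closedForm_le hM n hz) (norm_nonneg _) zero_le_one
    _ = 2 * (n + 1) * M := one_mul _

/-- **THE FLOORED INTEGRAL IS BOUNDED BY `2(n+1)μ(𝒪)`** when the floor is `‖a‖ ≥ 1` (all `x₀`), `aξ ∈ 𝔭^{m+n} ∖ 𝔭^{m+n+1}` and `Re z > ½`. [cite: Casselman1980, §3] -/
theorem norm_integral_floorWeight_mul_addChar_le {ψ : AddChar F Circle} (hψ : Continuous ψ) {m : ℤ} (hm : ψ.HasConductorExp m) {a : F} (ha1 : 1 ≤ normAbs F a)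
    {ξ : F} {n : ℕ} (hn : a * ξ ∈ primePowBall F (m + n)) (hn' : a * ξ ∉ primePowBall F (m + n + 1)) {z : ℂ} (hz : 1 / 2 < z.re) :
    ‖∫ t, (((max ((normAbs F a : ℝ≥0) : ℝ) ((normAbs F t : ℝ≥0) : ℝ) : ℝ) : ℂ) ^ (-(2 * z))) * ((ψ (t * ξ) : Circle) : ℂ) ∂μ‖ ≤
      2 * (n + 1) * μ.real (primePowBall F 0) := by
  have ha : a ≠ 0 := fun h => by rw [h, map_zero] at ha1; exact not_lt.mpr ha1 zero_lt_one
  rw [integral_floorWeight_mul_addChar_eq_closedForm μ hψ hm ha hn hn' hz]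
  exact norm_floorClosedForm_le (by exact_mod_cast ha1) measureReal_nonneg n hz.le

end Summit.HodgeConjecture.HodgeConjecture.Cruxes.H413.K2E1FourierJacobiLocalFiniteU3

end
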